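import Summits.ResolutionOfSingularities.ResolutionOfSingularities.Theorems.EquisingularLiftEquisingularLiftNatOrdinaryPointVertexChart
import Summits.ResolutionOfSingularities.ResolutionOfSingularities.Theorems.FrobeniusClosingPatchingRelPerfectQuotientRegularityTools
import HarnessLib

/-!
# [OURS · L1 W4.5(b)] THE VERTEX CHART OF A ONE-STEP POINT: regularity of the blow-up of `V(f) ⊂ 𝔸ᴺ⁺¹` at the origin along the exceptional divisor
# from the EXPLICIT STRICT-TRANSFORM POLYNOMIAL `f(T_a·T) = T_a^μ · G_a(T)` and the Jacobian criterion, any `N`, any `p`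
# (crux `Theses.EquisingularLift.EquisingularLiftNat`, stmt-ResolutionOfSingularities-20038)

NOT a statement of any manuscript; OURS kernel lemmas (cell `res-hironaka`, chain w45b; seat res-D-pv-013, own initiative, counted 0). AI-written,
weaker than expert review. No definition, no `sorry`, standard axioms.

`OrdPoint.isRegularLocalRing_localization_blowupAlgebra` (p544429) resolves an ORDINARY point (nonsingular tangent cone) by the derivative test of
res-L1-w45b-stub-3's T-EBETA-PRIME core. Many isolated singular points with SINGULAR tangent cone are nevertheless resolved by ONE blow-up — the
`A₂` points `y₀y₁ + y₂³` (surface) or `y₀y₁ + y₂³ + y₃² + …` (any dimension) — and the honest criterion is the Jacobian criterion for the strict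
transform on each chart of the blow-up. This file proves it in the form a specimen can check by polynomial identities:

* `A = K[y₀,…,y_N]`, `I = (y)`, `f = Φ + Ψ` with `Φ ≠ 0` homogeneous of degree `μ` and `Ψ ∈ I^{μ+1}`; chart `a`; a polynomial `G ∈ K[T₀,…,T_N]` with the
  TOTAL-TRANSFORM IDENTITY `f(T_a, T_aT_j (j ≠ a)) = T_a^μ · G` (`aeval (fun j => X a * update X a 1 j) f = X a ^ μ * G`);
* through `K[T] ≅ A[I/y_a]` (`T_a ↦ y_a`, `T_j ↦ y_j/y_a`; `ConeN.exists_algEquiv_pointChart`, any `N`) `G` goes to the strict transform `g₁ = Φ(e) + tψ` of the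
  core (`exists_algebraMap_tangentCone_eq`, cancelling `t^μ`), so `K[T]/(G) ≅ A[I/y_a]/(g₁) ≅ (A/(f))[Ī/ȳ_a]` (`exists_quotient_strictTransform_equiv_blowupAlgebra`);
* **`OneStep.isRegularLocalRing_localization_blowupAlgebra`** — if at every prime `P ∋ T_a, G` of `K[T]` some `∂G/∂T_j ∉ P` (`j` arbitrary, `j = a` allowed),
  then the localisations of `(A/(f))[Ī/ȳ_a]` at the primes containing `ȳ_a` are regular (the tree's pointwise Jacobian criterion
  `MvPolynomial.isRegularLocalRing_localization_quotient_of_pderiv_notMem`, transported).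

References: Görtz–Wedhorn I Prop. 13.96; The Stacks Project 0BIQ; Matsumura Thm. 14.2 — through the cited tree files.
-/

set_option linter.dupNamespace false -- mandated namespace `Summit.<Summit>.<Problem>` of this single-conjunct summit

noncomputable section

namespace Summit.ResolutionOfSingularities.ResolutionOfSingularities.Cruxes.EquisingularLiftNat.Sections

open MvPolynomial IsLocalization IsLocalRing Literature.AlgebraicGeometry.Resolution

namespace OneStep

/-- **`θ : K[T] ≅ A[𝔪/y_a]` takes the total-transform substitution to the structure map**: `θ(q(T_a, T_aT_j)) = q` in `A[𝔪/y_a]`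
(`T_a ↦ y_a`, `T_j ↦ y_j/y_a`; `ConeN.algebraMap_eq_aeval_exc_mul_frac`). [folklore] -/
theorem algEquiv_aeval_subst (K : Type) [Field K] {N : ℕ} (a : Fin (N + 1))
    (θ : MvPolynomial (Fin (N + 1)) K ≃ₐ[K] PointBlowup.Chart N K a) (hθa : θ (X a) = PointBlowup.exc N K a)
    (hθj : ∀ (j : Fin (N + 1)) (_ : j ≠ a), θ (X j) = PointBlowup.frac N K a j) (q : MvPolynomial (Fin (N + 1)) K) :
    θ (aeval (fun j => X a * Function.update (X : Fin (N + 1) → MvPolynomial (Fin (N + 1)) K) a 1 j) q) =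
      algebraMap (MvPolynomial (Fin (N + 1)) K) (PointBlowup.Chart N K a) q := by
  have hθupd : ∀ j : Fin (N + 1), θ (Function.update (X : Fin (N + 1) → MvPolynomial (Fin (N + 1)) K) a 1 j) = PointBlowup.frac N K a j := by
    intro j
    by_cases hj : j = a
    · subst hj
      rw [Function.update_self, map_one, PointBlowup.frac_self]
    · rw [Function.update_of_ne hj, hθj j hj]
  have h := MvPolynomial.algHom_ext (A := PointBlowup.Chart N K a)
    (f := (θ : MvPolynomial (Fin (N + 1)) K →ₐ[K] PointBlowup.Chart N K a).comp
      (aeval fun j => X a * Function.update (X : Fin (N + 1) → MvPolynomial (Fin (N + 1)) K) a 1 j))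
    (g := aeval fun j => PointBlowup.exc N K a * PointBlowup.frac N K a j) (fun j => by
      simp only [AlgHom.comp_apply, AlgEquiv.coe_toAlgHom, aeval_X, map_mul]
      rw [hθa, hθupd])
  have h' := DFunLike.congr_fun h q
  simp only [AlgHom.comp_apply, AlgEquiv.coe_toAlgHom] at h'
  rw [ConeN.algebraMap_eq_aeval_exc_mul_frac K q a]
  exact h'

/-- **`θ` takes the explicit strict transform `G` to any `g` with `f = t^μ·g` in `A[𝔪/y_a]`** (cancel `t^μ`, a non-zero-divisor). [folklore] -/
theorem algEquiv_apply_eq_of_subst (K : Type) [Field K] {N : ℕ} (a : Fin (N + 1))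
    (θ : MvPolynomial (Fin (N + 1)) K ≃ₐ[K] PointBlowup.Chart N K a) (hθa : θ (X a) = PointBlowup.exc N K a)
    (hθj : ∀ (j : Fin (N + 1)) (_ : j ≠ a), θ (X j) = PointBlowup.frac N K a j) {f G : MvPolynomial (Fin (N + 1)) K} {μ : ℕ}
    (hG : aeval (fun j => X a * Function.update (X : Fin (N + 1) → MvPolynomial (Fin (N + 1)) K) a 1 j) f = X a ^ μ * G)
    (g : PointBlowup.Chart N K a) (hg : algebraMap (MvPolynomial (Fin (N + 1)) K) (PointBlowup.Chart N K a) f = PointBlowup.exc N K a ^ μ * g) :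
    θ G = g := by
  have h1 := algEquiv_aeval_subst K a θ hθa hθj f
  rw [hG, map_mul, map_pow, hθa, hg] at h1
  have hsub : PointBlowup.exc N K a ^ μ * (θ G - g) = 0 := by
    rw [mul_sub, sub_eq_zero]
    exact h1
  rw [mul_left_mem_nonZeroDivisors_eq_zero_iff (pow_mem (PointBlowup.exc_mem_nonZeroDivisors N K a) μ), sub_eq_zero] at hsub
  exact hsub

set_option maxHeartbeats 800000 in -- the chart algebra `blowupAlgebra` is a subalgebra of a localisation: slow instance unification (as in …NatOrdinaryPointVertexChart)
/-- **THE VERTEX CHART OF A ONE-STEP POINT, PRIME BY PRIME.** `A = K[y₀,…,y_N]`, `I = (y)`, `f = Φ + Ψ` with `Φ ≠ 0` a form of degree `μ` and `Ψ ∈ I^{μ+1}`;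
`G ∈ K[T₀,…,T_N]` with `f(T_a, T_aT_j) = T_a^μ·G` (the strict transform of `f` on the `a`-th chart of the blow-up of the origin, as an explicit polynomial).
If at every prime `P` of `K[T]` containing `T_a` and `G` some partial derivative `∂G/∂T_j ∉ P`, then at every prime `𝔑` of the chart ring `(A/(f))[Ī/ȳ_a]`
containing the exceptional equation `ȳ_a` the local ring is regular: `K[T]/(G) ≅ A[I/y_a]/(g₁) ≅ (A/(f))[Ī/ȳ_a]` (`T_a ↦ y_a`, `T_j ↦ y_j/y_a`; `g₁` the core's
strict transform, `t^μ` cancelled in `A[I/y_a]`) and the pointwise Jacobian criterion for `K[T]/(G)`.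
[cite: GortzWedhorn2020, Prop. 13.96] [cite: Matsumura1987, Thm. 14.2] -/
theorem isRegularLocalRing_localization_blowupAlgebra (K : Type) [Field K] {N : ℕ} (Φ Ψ : MvPolynomial (Fin (N + 1)) K) {μ : ℕ}
    (hΦ : Φ.IsHomogeneous μ) (hΦ0 : Φ ≠ 0)
    (hΨ : Ψ ∈ Ideal.span (Set.range (X : Fin (N + 1) → MvPolynomial (Fin (N + 1)) K)) ^ (μ + 1)) (a : Fin (N + 1))
    (G : MvPolynomial (Fin (N + 1)) K)
    (hG : aeval (fun j => X a * Function.update (X : Fin (N + 1) → MvPolynomial (Fin (N + 1)) K) a 1 j) (Φ + Ψ) = X a ^ μ * G)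
    (hjac : ∀ P : Ideal (MvPolynomial (Fin (N + 1)) K), P.IsPrime → (X a : MvPolynomial (Fin (N + 1)) K) ∈ P → G ∈ P →
      ∃ j, pderiv j G ∉ P)
    (𝔑 : Ideal (blowupAlgebra ((Ideal.span (Set.range (X : Fin (N + 1) → MvPolynomial (Fin (N + 1)) K))).map
      (Ideal.Quotient.mk (Ideal.span {Φ + Ψ}))) (Ideal.Quotient.mk (Ideal.span {Φ + Ψ}) (X a)))) [𝔑.IsPrime]
    (h𝔑 : algebraMap (MvPolynomial (Fin (N + 1)) K ⧸ Ideal.span {Φ + Ψ}) _ (Ideal.Quotient.mk (Ideal.span {Φ + Ψ}) (X a)) ∈ 𝔑) :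
    IsRegularLocalRing (Localization.AtPrime 𝔑) := by
  classical
  have hx : IsQuasiRegular (X : Fin (N + 1) → MvPolynomial (Fin (N + 1)) K) := ConeN.isQuasiRegular_X K (N := N)
  haveI hdom : IsDomain (MvPolynomial (Fin (N + 1)) K ⧸ Ideal.span (Set.range (X : Fin (N + 1) → MvPolynomial (Fin (N + 1)) K))) :=
    ConeN.isDomain_quotient_origin K (N := N)
  -- the core's presentation `f = t^μ · g₁`, `g₁ = Φ(e) + tψ`
  have hΦ'h : (MvPolynomial.map (C : K →+* MvPolynomial (Fin (N + 1)) K) Φ).IsHomogeneous μ := hΦ.map _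
  have heval : MvPolynomial.eval (X : Fin (N + 1) → MvPolynomial (Fin (N + 1)) K) (MvPolynomial.map (C : K →+* MvPolynomial (Fin (N + 1)) K) Φ) = Φ := by
    rw [MvPolynomial.eval_map]
    exact MvPolynomial.eval₂_eta Φ
  obtain ⟨ψ, hcore⟩ := exists_algebraMap_tangentCone_eq (X : Fin (N + 1) → MvPolynomial (Fin (N + 1)) K) a hΦ'h hΨ
  rw [heval] at hcore
  have hΦbar : MvPolynomial.map (Ideal.Quotient.mk (Ideal.span (Set.range (X : Fin (N + 1) → MvPolynomial (Fin (N + 1)) K))))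
      (dehomogenize a (MvPolynomial.map (C : K →+* MvPolynomial (Fin (N + 1)) K) Φ)) ≠ 0 := by
    rw [← map_dehomogenize, MvPolynomial.map_map]
    haveI : Nontrivial (MvPolynomial (Fin (N + 1)) K ⧸ Ideal.span (Set.range (X : Fin (N + 1) → MvPolynomial (Fin (N + 1)) K))) :=
      hdom.toNontrivial
    intro h0
    apply dehomogenize_ne_zero_of_isHomogeneous a hΦ hΦ0
    exact (MvPolynomial.map_injective _ (RingHom.injective _)) (h0.trans (map_zero _).symm)
  obtain ⟨ε, hε⟩ := exists_quotient_strictTransform_equiv_blowupAlgebra (X : Fin (N + 1) → MvPolynomial (Fin (N + 1)) K) a hx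
    hΦbar ψ hcore
  -- `θ : K[T] ≅ A[I/y_a]` takes `G` to `g₁`
  obtain ⟨θ, hθa, hθj⟩ := ConeN.exists_algEquiv_pointChart K (N := N) a
  have hθG := algEquiv_apply_eq_of_subst K a θ hθa hθj hG _ hcore
  -- `K[T]/(G) ≅ A[I/y_a]/(g₁) ≅ (A/(f))[Ī/ȳ_a]`
  let η : (MvPolynomial (Fin (N + 1)) K ⧸ Ideal.span {G}) ≃+*
      (blowupAlgebra (Ideal.span (Set.range (X : Fin (N + 1) → MvPolynomial (Fin (N + 1)) K))) (X a) ⧸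
        Ideal.span {MvPolynomial.aeval (blowupAlgebra.frac (X : Fin (N + 1) → MvPolynomial (Fin (N + 1)) K) a)
          (MvPolynomial.map (C : K →+* MvPolynomial (Fin (N + 1)) K) Φ) +
          algebraMap (MvPolynomial (Fin (N + 1)) K) (blowupAlgebra (Ideal.span (Set.range (X : Fin (N + 1) → MvPolynomial (Fin (N + 1)) K))) (X a))
            (X a) * ψ}) :=
    Ideal.quotientEquiv _ _ θ.toRingEquiv (by
      rw [Ideal.map_span, Set.image_singleton]
      exact congrArg (fun b => Ideal.span {b}) hθG.symm)
  have he : ∀ q : MvPolynomial (Fin (N + 1)) K, ε (η (Ideal.Quotient.mk _ q)) =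
      blowupAlgebra.mapQuotient (Ideal.span (Set.range (X : Fin (N + 1) → MvPolynomial (Fin (N + 1)) K))) (X a) (Ideal.span {Φ + Ψ}) (θ q) :=
    fun q => by rw [show η (Ideal.Quotient.mk _ q) = Ideal.Quotient.mk _ (θ q) from Ideal.quotientEquiv_mk _ _ _ _ q, hε]
  -- the primes of `K[T]/(G)` and of `K[T]` under `𝔑`
  obtain ⟨Pbar, hPbar⟩ : ∃ P : Ideal (MvPolynomial (Fin (N + 1)) K ⧸ Ideal.span {G}), P = 𝔑.comap ((η.trans ε).toRingHom) := ⟨_, rfl⟩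
  haveI : Pbar.IsPrime := by rw [hPbar]; exact Ideal.comap_isPrime _ 𝔑
  have hmem : ∀ q, q ∈ Pbar ↔ ε (η q) ∈ 𝔑 := fun q => by rw [hPbar, Ideal.mem_comap]; rfl
  obtain ⟨P, hP⟩ : ∃ P : Ideal (MvPolynomial (Fin (N + 1)) K), P = Pbar.comap (Ideal.Quotient.mk (Ideal.span {G})) := ⟨_, rfl⟩
  haveI : P.IsPrime := by rw [hP]; exact Ideal.comap_isPrime _ Pbar
  have hmemP : ∀ q, q ∈ P ↔ ε (η (Ideal.Quotient.mk _ q)) ∈ 𝔑 := fun q => by rw [hP, Ideal.mem_comap, hmem]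
  have haP : (X a : MvPolynomial (Fin (N + 1)) K) ∈ P := by
    rw [hmemP, he, hθa]
    have hexc : blowupAlgebra.mapQuotient (Ideal.span (Set.range (X : Fin (N + 1) → MvPolynomial (Fin (N + 1)) K))) (X a)
        (Ideal.span {Φ + Ψ}) (PointBlowup.exc N K a) =
        algebraMap (MvPolynomial (Fin (N + 1)) K ⧸ Ideal.span {Φ + Ψ}) _ (Ideal.Quotient.mk (Ideal.span {Φ + Ψ}) (X a)) :=
      blowupAlgebra.mapQuotient_algebraMap _ _ _ (X a)
    rw [hexc]
    exact h𝔑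
  have hGP : G ∈ P := by
    rw [hmemP, Ideal.Quotient.eq_zero_iff_mem.mpr (Ideal.mem_span_singleton_self G), map_zero, map_zero]
    exact zero_mem _
  -- Jacobian, then transport
  obtain ⟨j, hj⟩ := hjac P inferInstance haP hGP
  have hj' : Ideal.Quotient.mk (Ideal.span {G}) (pderiv j G) ∉ Pbar := fun h => hj (by rw [hP, Ideal.mem_comap]; exact h)
  have hreg : IsRegularLocalRing (Localization.AtPrime Pbar) :=
    Summit.ResolutionOfSingularities.ResolutionOfSingularities.Theorems.MvPolynomial.isRegularLocalRing_localization_quotient_of_pderiv_notMem Pbar j hj'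
  exact OrdPoint.isRegularLocalRing_localization_of_ringEquiv (η.trans ε) Pbar 𝔑 (fun q => (hmem q).symm) hreg

end OneStep

end Summit.ResolutionOfSingularities.ResolutionOfSingularities.Cruxes.EquisingularLiftNat.Sections

end
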